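import Summits.ResolutionOfSingularities.ResolutionOfSingularities.Theorems.HomologicalConductorNoZenoRNonIsoLocus
import Literature.AlgebraicGeometry.Resolution.ExceptionalFibreConnected
import Literature.AlgebraicGeometry.Resolution.ResolutionGlue
import Literature.AlgebraicGeometry.Resolution.PrincipalizationToResolution
import Literature.AlgebraicGeometry.Morphisms.FiniteBirationalIso
import HarnessLib

/-!
# Crux `NoZenoR` (stmt-ResolutionOfSingularities-19943) — the STEIN property of an `S`-morphism between
# desingularizations over affine opens: `Γ(U, 𝒪_Y) ⥲ Γ(h⁻¹U, 𝒪_X)`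

Route `ResolutionOfSingularities/HomologicalConductor` (cell decomp-res, hand leafhand-res-homologicalconduct-18 g1).
OURS: AI-written proof over tree theorems, weaker than expert review; nothing here is a statement of the manuscript
under review (Hironaka 2017).  SUPPORT level, counted 0.  Def-free, no new named facts.

* `isIntegrallyClosed_sections_of_isRegular` — affine opens of a regular integral scheme have integrally closed
  coordinate rings;
* **`isIso_appTop_morphismRestrict`** — for `S` a Noetherian domain, desingularizations `ρ : Y → Spec S`, `h ≫ ρ`, and an
  affine open `U ⊆ Y`, the restriction `h ∣_ U : h⁻¹U → U` induces an ISOMORPHISM on global sections: `h ∣_ U` followed by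
  `U ≅ Spec Γ(Y, U)` is a resolution of the spectrum of the Noetherian normal domain `Γ(Y, U)`, whose global sections are
  the base ring (tree `IsResolution.isIso_appTop`, `H⁰(X, 𝒪_X) = T`).  This is the Stein hypothesis `hStein` of
  `FirstKind.exists_local_fac_of_stein` for blow-downs between desingularizations.

No crux or summit statement is proved here.
-/

noncomputable section

-- single-problem summit: the doubled namespace component `ResolutionOfSingularities` is forced
set_option linter.dupNamespace false

open CategoryTheory AlgebraicGeometry TopologicalSpace Topology IsLocalRing
open Literature.AlgebraicGeometry.Resolution Literature.AlgebraicGeometry.Morphisms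
open Summit.ResolutionOfSingularities.ResolutionOfSingularities.Theorems.NoZeno.ExcCount

universe u

namespace Summit.ResolutionOfSingularities.ResolutionOfSingularities.Theorems.NoZeno.FirstKind

/-- Affine opens of a regular integral scheme have integrally closed coordinate rings (regular local rings are
factorial, hence normal; `Morphisms.isIntegrallyClosed_sections_of_stalks`). [cite: GortzWedhorn2020, Lemma 6.38 (1)] -/
theorem isIntegrallyClosed_sections_of_isRegular {Y : Scheme.{u}} [IsIntegral Y] (hY : Scheme.IsRegular Y)
    {U : Y.Opens} (hU : IsAffineOpen U) (hne : (U : Set Y).Nonempty) : IsIntegrallyClosed Γ(Y, U) := by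
  refine isIntegrallyClosed_sections_of_stalks hU hne fun y _ => ?_
  haveI := hY y
  haveI := isDomain_of_isRegularLocalRing (Y.presheaf.stalk y)
  haveI := uniqueFactorizationMonoid_of_isRegularLocalRing (Y.presheaf.stalk y) (hY y)
  infer_instance

/-- The global-sections map of an isomorphism of schemes is an isomorphism. [folklore] -/
theorem isIso_appTop_of_isIso {X Y : Scheme.{u}} (f : X ⟶ Y) [IsIso f] : IsIso f.appTop := by
  refine ⟨⟨(inv f).appTop, ?_, ?_⟩⟩
  · rw [← Scheme.Hom.comp_appTop, IsIso.inv_hom_id, Scheme.Hom.id_appTop]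
  · rw [← Scheme.Hom.comp_appTop, IsIso.hom_inv_id, Scheme.Hom.id_appTop]

/-- **Stein property over affine opens for a morphism of desingularizations**: for `S` a Noetherian domain,
`ρ : Y → Spec S` and `h ≫ ρ : X → Spec S` desingularizations and `U ⊆ Y` an affine open, the global-sections map of
`h ∣_ U : h⁻¹(U) → U` is an isomorphism (`Γ(U, 𝒪_Y) = Γ(h⁻¹U, 𝒪_X)`: `h⁻¹U → U ≅ Spec Γ(Y,U)` is proper birational with
regular source onto the spectrum of a Noetherian normal domain). [cite: Lipman1969, Section 1 (p. 199)];
[cite: StacksProject, Tag 0AY8] -/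
theorem isIso_appTop_morphismRestrict {S : Type u} [CommRing S] [IsNoetherianRing S] [IsDomain S]
    {X Y : Scheme.{u}} {ρ : Y ⟶ Spec (.of S)} {h : X ⟶ Y} (hπ : IsResolution (h ≫ ρ)) (hρ : IsResolution ρ)
    {U : Y.Opens} (hU : IsAffineOpen U) : IsIso (h ∣_ U).appTop := by
  haveI : IsIntegral Y := hρ.isIntegral_source
  haveI : IsIntegral X := hπ.isIntegral_source
  haveI : IsProper ρ := hρ.isProper
  haveI : IsProper (h ≫ ρ) := hπ.isProper
  haveI : IsProper h := IsProper.of_comp h ρ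
  haveI : IsLocallyNoetherian Y := LocallyOfFiniteType.isLocallyNoetherian ρ
  have hbir : IsBirational h := isBirational_of_fac hπ.isBirational hρ.isBirational
  -- the empty open: both sides are the zero ring
  rcases (U : Set Y).eq_empty_or_nonempty with hUe | hne
  · have hU0 : U = ⊥ := TopologicalSpace.Opens.ext (by rw [hUe]; rfl)
    subst hU0
    haveI : IsEmpty (↑(h ⁻¹ᵁ (⊥ : Y.Opens)) : Scheme.{u}) := by
      change IsEmpty (h ⁻¹ᵁ ⊥ : X.Opens)
      rw [Scheme.Hom.preimage_bot]
      exact Set.isEmpty_coe_sort.mpr rfl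
    haveI : IsEmpty (↑(⊥ : Y.Opens) : Scheme.{u}) := Set.isEmpty_coe_sort.mpr rfl
    haveI : IsIso (h ∣_ (⊥ : Y.Opens)) := isIso_of_isEmpty _
    exact isIso_appTop_of_isIso _
  -- the coordinate ring `Γ(Y, U)` is a Noetherian normal domain
  haveI : Nonempty U := hne.to_subtype
  haveI : IsAffine (U : Scheme.{u}) := hU
  haveI : IsNoetherianRing Γ(Y, U) := IsLocallyNoetherian.component_noetherian ⟨U, hU⟩
  haveI : IsIntegrallyClosed Γ(Y, U) := isIntegrallyClosed_sections_of_isRegular hρ.isRegular hU hne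
  -- `h ∣_ U` followed by `U ≅ Spec Γ(Y, U)` is a resolution of `Spec Γ(Y, U)`
  set e := hU.isoSpec with he
  have hres : IsResolution ((h ∣_ U) ≫ e.hom) := by
    refine ⟨inferInstance, (hbir.morphismRestrict U).comp_iso e.hom, ?_⟩
    exact Scheme.IsRegular.of_isOpenImmersion (h ⁻¹ᵁ U).ι hπ.isRegular
  have hiso : IsIso ((h ∣_ U) ≫ e.hom).appTop := IsResolution.isIso_appTop (T := Γ(Y, U)) hres
  rw [Scheme.Hom.comp_appTop] at hiso
  haveI : IsIso e.hom.appTop := isIso_appTop_of_isIso e.hom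
  exact IsIso.of_isIso_comp_left e.hom.appTop (h ∣_ U).appTop

end Summit.ResolutionOfSingularities.ResolutionOfSingularities.Theorems.NoZeno.FirstKind

end
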